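import Literature.NumberTheory.IwasawaTheory.UnramifiedOutsidePTowerFinite
import Literature.NumberTheory.IwasawaTheory.CyclotomicTowerPrimesAboveBound
import Literature.NumberTheory.IwasawaTheory.EquivariantUnramifiedHomsZpTowerFinite
import Mathlib.GroupTheory.Abelianization.Defs
import HarnessLib

/-!
# Finiteness of the everywhere-unramified classes with values in a Galois module of prime order `p`, from a CM tower
# with linear class-number growth (Greenberg's Lemma 5.9, the assembly over a general base; proved, no named fact)

Topic `NumberTheory/IwasawaTheory` (namespace `Literature.NumberTheory.IwasawaTheory.UnramifiedOutsidePFiniteOfCMTower`).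
THEOREM-ONLY file written by the prover seat `bsd-eis-lam-a` g20 (cell `bsd-eis`; `--supports`
stmt-BirchSwinnertonDyer-19035, crux 5 `MazurMCOnX1RankZero`, stub `stub_publishedL59`; closes nothing).

Greenberg (LNM 1716, Lemma 5.9 and its proof, pp. 142–144) shows that for an odd prime `p`, the cyclotomic
`ℤ_p`-extension `ℚ_∞/ℚ` and a `Gal(ℚ_Σ/ℚ)`-module `Θ` of order `p` on which complex conjugation acts trivially,
`H¹(ℚ_Σ/ℚ_∞, Θ)` is finite: with `θ` the character of `Θ`, `K = ℚ(θ, μ_p)^+ · ℚ_∞`-layers are CM fields in which only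
the primes above `p` ramify, the unramified classes inject (restriction to a subgroup of index prime to `p` with trivial
action) into `Hom`'s counted by Kummer theory and the reflection principle, and the Ferrero–Washington theorem bounds the
minus class numbers linearly in the level.  This file is the ASSEMBLY of that argument over a general number field `K`,
with every arithmetic input an explicit hypothesis:

* **`finite_unramifiedOutside_of_cmTower`** — let `κ` be a `ℤ_p`-extension of `K` (`p ≠ 2`), `Θ` a discrete
  `Γ_K`-module of order `p` with continuous action, `N ⊴ Γ_K` open, acting trivially on `Θ`, containing the commutator
  subgroup, of index prime to `p` and fixing a primitive `p`-th root of unity `ζ ∈ K̄`; let `c ∈ Γ_K` be a complex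
  conjugation (for an embedding `ι : K̄ → ℂ`) acting trivially on `Θ`; assume the fields `L_n = K̄^{N ∩ Γ_n}`
  (`Γ_n = Gal(K̄/K_n)`) are CM, that `K` has a single place `v` above `p`, totally ramified in `K_∞` in the form
  `I_𝔓 ⊔ Gal(K̄/K_∞) = Γ_K`, and that `ord_p h(L_n) ≤ l·n + ν` for `n ≥ n₀`.  Then the subgroup of classes of
  `H¹(Gal(K̄/K_∞), Θ)` unramified at every place not above `p` is finite.

The proof feeds the generic tower theorem `UnramifiedOutsidePTowerFinite.finite_unramifiedOutside_of_layerData` with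
`U_n = (N ∩ Γ_n) · ⟨c⟩` (normal since `Γ_K/(N ∩ Γ_n)` is abelian; inside `Γ_n` because `c ∈ ker κ`, `c² = 1`), whose fixed
field is identified with the maximal real subfield of `L_n` through `ι ∘ complexConj = conj ∘ ι`
(`IsCMField.complexEmbedding_complexConj`), and with the layer bound assembled from
`CyclotomicTowerPrimesAboveBound.ncard_primesOver_mul_pow_le_index` (at most `[Γ_K : N]` primes of `L_n` above `p`) and
the class-number growth hypothesis.  Helpers of independent use: `fixedField_inf_of_isOpen`
(`K̄^{A ∩ B} = K̄^A K̄^B` for open `A, B`), `layer_eq_fixedField`,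
`commute_of_commutator_le` (with the tree's `EquivariantUnramifiedHomsZpTowerFinite.isGalois_fixedField_of_isOpen`), `mem_kerSubgroup_of_mul_self`, `isTotallyComplex_of_isPrimitiveRoot`.

References: [GreenbergLNM1716] §5 Lemma 5.9 (statement p. 142, proof pp. 143–144); [Washington1997] §13.1 (layers of a
`ℤ_p`-extension), Thm. 10.10–10.11 (reflection); [NeukirchANT1999] Ch. IV §1 (infinite Galois theory).
-/

set_option autoImplicit false

noncomputable section

open scoped Classical Pointwise NumberField ComplexConjugate commutatorElement
open NumberField IsDedekindDomain Field IntermediateField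

namespace Literature.NumberTheory.IwasawaTheory.UnramifiedOutsidePFiniteOfCMTower

open Literature.NumberTheory.EllipticCurves Literature.NumberTheory.EllipticCurves.GreenbergSelmer
  Literature.NumberTheory.EllipticCurves.GreenbergVatsal2000
  Literature.NumberTheory.GaloisRepresentations Literature.NumberTheory.NumberFields
  Literature.NumberTheory.IwasawaTheory.UnramifiedOutsidePTowerFinite
  Literature.NumberTheory.IwasawaTheory.CyclotomicTowerPrimesAboveBound
  Literature.NumberTheory.IwasawaTheory.EquivariantUnramifiedHomsZpTowerFinite

/-! ## §0 Helpers -/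

section Group

variable {G : Type*} [Group G]

/-- A subgroup containing the commutator subgroup is normal. [folklore] -/
private theorem normal_of_commutator_le (H : Subgroup G) (h : ⁅(⊤ : Subgroup G), ⊤⁆ ≤ H) : H.Normal := by
  refine ⟨fun n hn g => ?_⟩
  have h1 : ⁅g, n⁆ * n = g * n * g⁻¹ := by
    rw [commutatorElement_def, inv_mul_cancel_right]
  rw [← h1]
  exact H.mul_mem (h (Subgroup.commutator_mem_commutator (Subgroup.mem_top g) (Subgroup.mem_top n))) hn

end Group

section Galois

variable {K : Type} [Field K]

/-- `K̄^{A ∩ B} = K̄^A · K̄^B` for open subgroups `A, B ≤ Γ_K` (Krull's Galois correspondence).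
[cite: NeukirchANT1999, Ch. IV §1 Thm. (1.2)] -/
theorem fixedField_inf_of_isOpen [CharZero K] (A B : Subgroup (absoluteGaloisGroup K))
    (hA : IsOpen (A : Set (absoluteGaloisGroup K))) (hB : IsOpen (B : Set (absoluteGaloisGroup K))) :
    (fixedField (A ⊓ B) : IntermediateField K (AlgebraicClosure K)) = fixedField A ⊔ fixedField B := by
  have h := IntermediateField.fixingSubgroup_sup
    (K := (fixedField A : IntermediateField K (AlgebraicClosure K)))
    (L := (fixedField B : IntermediateField K (AlgebraicClosure K)))
  rw [fixingSubgroup_fixedField_of_isOpen A hA, fixingSubgroup_fixedField_of_isOpen B hB] at h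
  rw [← h]
  exact InfiniteGalois.fixedField_fixingSubgroup _

/-- The `n`-th layer of a `ℤ_p`-extension is the fixed field of `κ⁻¹(pⁿℤ_p)` (the tree's `ZpExtension.layer`, with the
identity `absoluteGaloisGroup.toAlgEquiv` removed). [cite: Washington1997, §13.1] -/
theorem layer_eq_fixedField {p : ℕ} [Fact p.Prime] (κ : ZpExtension K p) (n : ℕ) :
    κ.layer n = fixedField (κ.layerSubgroup n) := by
  change fixedField _ = _
  congr 1
  ext σ
  rw [Subgroup.mem_map]
  constructor
  · rintro ⟨x, hx, rfl⟩; exact hx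
  · intro h; exact ⟨σ, h, rfl⟩

/-- `K̄^{N ∩ κ⁻¹(pⁿℤ_p)} = K̄^N · K_n` for an open subgroup `N ≤ Γ_K`. [cite: Washington1997, §13.1] -/
theorem fixedField_inf_layerSubgroup [CharZero K] {p : ℕ} [Fact p.Prime] (κ : ZpExtension K p)
    (N : Subgroup (absoluteGaloisGroup K)) (hN : IsOpen (N : Set (absoluteGaloisGroup K))) (n : ℕ) :
    (fixedField (N ⊓ κ.layerSubgroup n) : IntermediateField K (AlgebraicClosure K)) = fixedField N ⊔ κ.layer n := by
  rw [fixedField_inf_of_isOpen N _ hN (κ.isOpen_layerSubgroup n), layer_eq_fixedField]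

/-- The fixed field of an open subgroup of `Γ_K`, `K` a number field, is a number field. [cite: NeukirchANT1999, Ch. IV §1] -/
theorem numberField_fixedField_of_isOpen [NumberField K] (V : Subgroup (absoluteGaloisGroup K))
    (hV : IsOpen (V : Set (absoluteGaloisGroup K))) :
    NumberField (fixedField V : IntermediateField K (AlgebraicClosure K)) := by
  haveI := finiteDimensional_fixedField_of_isOpen V hV
  exact NumberField.of_module_finite K _

/-- If `V ⊴ Γ_K` is open and contains the commutator subgroup, `Gal(K̄^V/K)` is commutative.
[cite: NeukirchANT1999, Ch. IV §1] -/
theorem commute_of_commutator_le [CharZero K] (V : Subgroup (absoluteGaloisGroup K)) [V.Normal]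
    (hV : IsOpen (V : Set (absoluteGaloisGroup K)))
    (hcomm : ⁅(⊤ : Subgroup (absoluteGaloisGroup K)), ⊤⁆ ≤ V)
    (σ τ : (fixedField V : IntermediateField K (AlgebraicClosure K)) ≃ₐ[K]
      (fixedField V : IntermediateField K (AlgebraicClosure K))) : σ * τ = τ * σ := by
  haveI := isGalois_fixedField_of_isOpen V hV
  obtain ⟨s, rfl⟩ := absRestrictNormalHom_surjective
    (fixedField V : IntermediateField K (AlgebraicClosure K)) σ
  obtain ⟨t, rfl⟩ := absRestrictNormalHom_surjective
    (fixedField V : IntermediateField K (AlgebraicClosure K)) τ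
  rw [← map_mul, ← map_mul, ← mul_inv_eq_one, ← map_inv, ← map_mul, absRestrictNormalHom_eq_one_iff_forall_smul]
  intro x
  have hmem : s * t * (t * s)⁻¹ ∈ V := by
    have h1 : s * t * (t * s)⁻¹ = ⁅s, t⁆ := by rw [commutatorElement_def]; group
    rw [h1]
    exact hcomm (Subgroup.commutator_mem_commutator (Subgroup.mem_top s) (Subgroup.mem_top t))
  exact (mem_fixedField_iff V (x : AlgebraicClosure K)).mp x.2 _ hmem

/-- An element of `Γ_K` of order dividing `2` lies in the kernel of every `ℤ_p`-extension (`ℤ_p` is torsion-free).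
[cite: Washington1997, §13.1] -/
theorem mem_kerSubgroup_of_mul_self {p : ℕ} [Fact p.Prime] (κ : ZpExtension K p) {c : absoluteGaloisGroup K}
    (hc : c * c = 1) : c ∈ κ.kerSubgroup := by
  rw [ZpExtension.mem_kerSubgroup]
  have h1 : κ c * κ c = 1 := by rw [← map_mul, hc, map_one]
  have h2 : (κ c).toAdd + (κ c).toAdd = 0 := by
    have := congrArg Multiplicative.toAdd h1
    rwa [toAdd_mul, toAdd_one] at this
  have h3 : (κ c).toAdd = 0 := add_self_eq_zero.mp h2
  rw [← ofAdd_toAdd (κ c), h3, ofAdd_zero]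

end Galois

/-- A number field containing a primitive `k`-th root of unity, `k > 2`, is totally complex.
[cite: Washington1997, §13.1] -/
theorem isTotallyComplex_of_isPrimitiveRoot (L : Type*) [Field L] [NumberField L] {ζ : L} {k : ℕ}
    (hζ : IsPrimitiveRoot ζ k) (hk : 2 < k) : IsTotallyComplex L :=
  NumberField.nrRealPlaces_eq_zero_iff.mp (NumberField.InfinitePlace.IsPrimitiveRoot.nrRealPlaces_eq_zero_of_two_lt hk hζ)

/-! ## §1 The assembly -/

variable {K : Type} [Field K] [NumberField K] {p : ℕ} [Fact p.Prime]

/-- In a CM field `L = K̄^V ⊆ K̄` and for a complex conjugation `c ∈ Γ_K` (w.r.t. `ι : K̄ → ℂ`), the CM complex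
conjugation of `L` is the restriction of `c`. [cite: Washington1997, §13.1] -/
theorem coe_complexConj_eq_smul (V : Subgroup (absoluteGaloisGroup K))
    [NumberField (fixedField V : IntermediateField K (AlgebraicClosure K))]
    [IsCMField (fixedField V : IntermediateField K (AlgebraicClosure K))]
    (ι : AlgebraicClosure K →+* ℂ) (c : absoluteGaloisGroup K)
    (hc : ∀ x : AlgebraicClosure K, ι (c • x) = starRingEnd ℂ (ι x))
    (y : (fixedField V : IntermediateField K (AlgebraicClosure K))) :
    ((IsCMField.complexConj (fixedField V : IntermediateField K (AlgebraicClosure K)) y :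
      (fixedField V : IntermediateField K (AlgebraicClosure K))) : AlgebraicClosure K) =
      c • (y : AlgebraicClosure K) := by
  apply ι.injective
  have h := IsCMField.complexEmbedding_complexConj (fixedField V : IntermediateField K (AlgebraicClosure K))
    (ι.comp (algebraMap (fixedField V : IntermediateField K (AlgebraicClosure K)) (AlgebraicClosure K))) y
  rw [RingHom.comp_apply, RingHom.comp_apply] at h
  rw [hc]
  exact h

omit [NumberField K] in
/-- Membership in `K̄^{V ⊔ ⟨c⟩}`: fixed by `V` and by `c`. [folklore] -/
private theorem mem_fixedField_sup_zpowers_iff (V : Subgroup (absoluteGaloisGroup K)) (c : absoluteGaloisGroup K)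
    (x : AlgebraicClosure K) :
    x ∈ (fixedField (V ⊔ Subgroup.zpowers c) : IntermediateField K (AlgebraicClosure K)) ↔
      x ∈ (fixedField V : IntermediateField K (AlgebraicClosure K)) ∧ c • x = x := by
  constructor
  · intro hx
    have hx' := (mem_fixedField_iff (V ⊔ Subgroup.zpowers c) x).mp hx
    exact ⟨(mem_fixedField_iff V x).mpr fun σ hσ => hx' σ (Subgroup.mem_sup_left hσ),
      hx' c (Subgroup.mem_sup_right (Subgroup.mem_zpowers c))⟩
  · rintro ⟨hxV, hxc⟩
    rw [mem_fixedField_iff]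
    intro σ hσ
    have h : V ⊔ Subgroup.zpowers c ≤ MulAction.stabilizer (absoluteGaloisGroup K) x :=
      sup_le (fun τ hτ => (mem_fixedField_iff V x).mp hxV τ hτ) ((Subgroup.zpowers_le).mpr hxc)
    exact h hσ

/-- **Greenberg's Lemma 5.9, assembled over a general base.**  See the module docstring; the layer subgroups are
passed as a family `V` with `V n = N ⊓ κ⁻¹(pⁿℤ_p)` (hypothesis `hV`) so that callers control the syntactic form of
`K̄^{V n}`. [cite: GreenbergLNM1716, §5 Lemma 5.9 (proof, pp. 143–144)] [cite: Washington1997, §13.1 and Thm. 10.10] -/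
theorem finite_unramifiedOutside_of_cmTower (hp2 : p ≠ 2) (κ : ZpExtension K p)
    {Θ : Type} [AddCommGroup Θ] [DistribMulAction (absoluteGaloisGroup K) Θ] [TopologicalSpace Θ]
    [DiscreteTopology Θ] (hΘ : Nat.card Θ = p)
    (hcont : ∀ m : Θ, Continuous fun g : absoluteGaloisGroup K => g • m)
    (N : Subgroup (absoluteGaloisGroup K)) [N.Normal] (hNopen : IsOpen (N : Set (absoluteGaloisGroup K)))
    (hNΘ : ∀ σ ∈ N, ∀ m : Θ, σ • m = m) (hNcomm : ⁅(⊤ : Subgroup (absoluteGaloisGroup K)), ⊤⁆ ≤ N)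
    (hNcop : N.index.Coprime p)
    (V : ℕ → Subgroup (absoluteGaloisGroup K)) (hV : ∀ n, V n = N ⊓ κ.layerSubgroup n)
    {ζ : AlgebraicClosure K} (hζ : IsPrimitiveRoot ζ p) (hζN : ∀ σ ∈ N, σ • ζ = ζ)
    (ι : AlgebraicClosure K →+* ℂ) (c : absoluteGaloisGroup K)
    (hc : ∀ x : AlgebraicClosure K, ι (c • x) = starRingEnd ℂ (ι x)) (hcΘ : ∀ m : Θ, c • m = m)
    (hCM : ∀ n, IsCMField (fixedField (V n) : IntermediateField K (AlgebraicClosure K)))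
    {v : HeightOneSpectrum (𝓞 K)} (huniq : ∀ w : HeightOneSpectrum (𝓞 K), ((p : ℕ) : 𝓞 K) ∈ w.asIdeal → w = v)
    {𝔓 : Ideal (absIntegers (𝓞 K) K)} (h𝔓 : 𝔓 ∈ v.primesAbove)
    (htot : 𝔓.inertia (absoluteGaloisGroup K) ⊔ κ.kerSubgroup = ⊤)
    {l ν n₀ : ℕ}
    (hgrowth : ∀ n, n₀ ≤ n → padicValNat p (Nat.card (ClassGroup
      (𝓞 (fixedField (V n) : IntermediateField K (AlgebraicClosure K))))) ≤ l * n + ν) :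
    ((unramifiedOutside κ.kerSubgroup Θ p (∅ : Set (HeightOneSpectrum (𝓞 K))) :
      AddSubgroup (subgroupH1 κ.kerSubgroup Θ)) : Set (subgroupH1 κ.kerSubgroup Θ)).Finite := by
  classical
  have hpr : p.Prime := Fact.out
  haveI : Finite Θ := Nat.finite_of_card_ne_zero (by rw [hΘ]; exact hpr.ne_zero)
  have hpM : ∀ m : Θ, p • m = 0 := fun m => by rw [← hΘ]; exact card_nsmul_eq_zero'
  have hcardM : Nat.card Θ = p ^ 1 := by rw [pow_one, hΘ]
  -- `c² = 1`, so `c ∈ ker κ`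
  have hc2 : c * c = 1 := by
    have h : ∀ x : AlgebraicClosure K, (c * c) • x = x := fun x =>
      ι.injective (by rw [mul_smul, hc, hc, starRingEnd_self_apply])
    exact FaithfulSMul.eq_of_smul_eq_smul (M := absoluteGaloisGroup K) (α := AlgebraicClosure K)
      (fun x => by rw [h x, one_smul])
  have hcker : c ∈ κ.kerSubgroup := mem_kerSubgroup_of_mul_self κ hc2
  -- the subgroups `V n = N ∩ κ⁻¹(pⁿℤ_p)`
  haveI hVn : ∀ n, (V n).Normal := fun n => by rw [hV n]; infer_instance
  have hck : ⁅(⊤ : Subgroup (absoluteGaloisGroup K)), ⊤⁆ ≤ κ.kerSubgroup := by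
    rw [← commutator_def]
    exact Abelianization.commutator_subset_ker κ.toContinuousMonoidHom.toMonoidHom
  have hcommV : ∀ n, ⁅(⊤ : Subgroup (absoluteGaloisGroup K)), ⊤⁆ ≤ V n := fun n => by
    rw [hV n]
    exact le_inf hNcomm (hck.trans (κ.kerSubgroup_le_layerSubgroup n))
  have hVopen : ∀ n, IsOpen ((V n : Subgroup (absoluteGaloisGroup K)) : Set (absoluteGaloisGroup K)) :=
    fun n => by rw [hV n]; exact hNopen.inter (κ.isOpen_layerSubgroup n)
  have hVN : ∀ n, V n ≤ N := fun n => by rw [hV n]; exact inf_le_left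
  have hVle : ∀ n, V n ≤ κ.layerSubgroup n := fun n => by rw [hV n]; exact inf_le_right
  -- the subgroups `U_n = V_n ⊔ ⟨c⟩`
  haveI hUn : ∀ n, (V n ⊔ Subgroup.zpowers c).Normal := fun n =>
    normal_of_commutator_le _ ((hcommV n).trans le_sup_left)
  have hUopen : ∀ n, IsOpen ((V n ⊔ Subgroup.zpowers c : Subgroup (absoluteGaloisGroup K)) :
      Set (absoluteGaloisGroup K)) := fun n => Subgroup.isOpen_mono le_sup_left (hVopen n)
  have hUle : ∀ n, V n ⊔ Subgroup.zpowers c ≤ κ.layerSubgroup n := fun n =>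
    sup_le (hVle n) ((Subgroup.zpowers_le).mpr (κ.kerSubgroup_le_layerSubgroup n hcker))
  have hUtriv : ∀ n, ∀ σ ∈ V n ⊔ Subgroup.zpowers c, ∀ m : Θ, σ • m = m := by
    intro n σ hσ m
    have h : V n ⊔ Subgroup.zpowers c ≤ MulAction.stabilizer (absoluteGaloisGroup K) m :=
      sup_le (fun τ hτ => hNΘ τ (hVN n hτ) m) ((Subgroup.zpowers_le).mpr (hcΘ m))
    exact h hσ
  have hUcop : ∀ n, ((V n ⊔ Subgroup.zpowers c).subgroupOf (κ.layerSubgroup n)).index.Coprime p := by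
    intro n
    have h1 : (V n ⊔ Subgroup.zpowers c).relIndex (κ.layerSubgroup n) ∣ (V n).relIndex (κ.layerSubgroup n) :=
      Subgroup.relIndex_dvd_of_le_left _ le_sup_left
    have h2 : (V n).relIndex (κ.layerSubgroup n) ∣ N.index := by
      rw [hV n, Subgroup.inf_relIndex_right]
      exact Subgroup.relIndex_dvd_index_of_normal _ _
    exact Nat.Coprime.coprime_dvd_left (h1.trans h2) hNcop
  -- the fields `L_n = K̄^{V_n}`
  haveI hNF : ∀ n, NumberField (fixedField (V n) : IntermediateField K (AlgebraicClosure K)) :=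
    fun n => numberField_fixedField_of_isOpen _ (hVopen n)
  haveI hCM' : ∀ n, IsCMField (fixedField (V n) : IntermediateField K (AlgebraicClosure K)) := hCM
  have hζV : ∀ n, ζ ∈ (fixedField (V n) : IntermediateField K (AlgebraicClosure K)) :=
    fun n => (mem_fixedField_iff _ _).mpr fun σ hσ => hζN σ (hVN n hσ)
  have hζ' : ∀ n, IsPrimitiveRoot (⟨ζ, hζV n⟩ : (fixedField (V n) : IntermediateField K (AlgebraicClosure K))) p :=
    fun n => IsPrimitiveRoot.coe_submonoidClass_iff.mp hζ
  -- the maximal real subfield of `L_n` is `K̄^{U_n}`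
  have hreal : ∀ n (y : (fixedField (V n) : IntermediateField K (AlgebraicClosure K))),
      y ∈ maximalRealSubfield (fixedField (V n) : IntermediateField K (AlgebraicClosure K)) ↔
        c • (y : AlgebraicClosure K) = y := by
    intro n y
    rw [← IsCMField.complexConj_eq_self_iff _ y, ← coe_complexConj_eq_smul _ ι c hc y]
    exact Subtype.ext_iff
  let eL : ∀ n, (fixedField (V n ⊔ Subgroup.zpowers c) : IntermediateField K (AlgebraicClosure K)) ≃+*
      maximalRealSubfield (fixedField (V n) : IntermediateField K (AlgebraicClosure K)) :=
    fun n =>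
    { toFun := fun x => ⟨⟨x.1, ((mem_fixedField_sup_zpowers_iff _ c x.1).mp x.2).1⟩,
        (hreal n _).mpr ((mem_fixedField_sup_zpowers_iff _ c x.1).mp x.2).2⟩
      invFun := fun y => ⟨(y.1 : AlgebraicClosure K),
        (mem_fixedField_sup_zpowers_iff _ c _).mpr ⟨y.1.2, (hreal n y.1).mp y.2⟩⟩
      left_inv := fun x => rfl
      right_inv := fun y => rfl
      map_mul' := fun x y => rfl
      map_add' := fun x y => rfl }
  -- the layer bound
  have hbound : ∀ n, n₀ ≤ n →
      1 + Nat.card {w : HeightOneSpectrum (𝓞 (fixedField (V n) : IntermediateField K (AlgebraicClosure K))) //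
          ((p : ℕ) : 𝓞 (fixedField (V n) : IntermediateField K (AlgebraicClosure K))) ∈ w.asIdeal} +
        padicValNat p (Nat.card ↥((powMonoidHom p :
          ClassGroup (𝓞 (fixedField (V n) : IntermediateField K (AlgebraicClosure K))) →*
            ClassGroup (𝓞 (fixedField (V n) : IntermediateField K (AlgebraicClosure K)))).ker ⊓
          (classGroupNorm (maximalRealSubfield (fixedField (V n) : IntermediateField K (AlgebraicClosure K)))
            (fixedField (V n) : IntermediateField K (AlgebraicClosure K))).ker)) ≤
        l * n + (1 + N.index + ν) := by
    intro n hn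
    have hs : Nat.card {w : HeightOneSpectrum (𝓞 (fixedField (V n) : IntermediateField K (AlgebraicClosure K))) //
          ((p : ℕ) : 𝓞 (fixedField (V n) : IntermediateField K (AlgebraicClosure K))) ∈ w.asIdeal} ≤
        N.index := by
      have h1 := natCard_primes_mem_le_ncard_primesOver (K := K) (p := p)
        (fixedField (V n) : IntermediateField K (AlgebraicClosure K)) huniq
      have h2 := ncard_primesOver_mul_pow_le_index κ (V n) (hVopen n) (hVle n) h𝔓 htot
      have h3 : (V n).index ≤ N.index * p ^ n := by
        calc (V n).index ≤ N.index * (κ.layerSubgroup n).index := by rw [hV n]; exact Subgroup.index_inf_le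
          _ = N.index * p ^ n := by rw [κ.index_layerSubgroup n]
      exact h1.trans (Nat.le_of_mul_le_mul_right (h2.trans h3) (pow_pos hpr.pos n))
    have hC : padicValNat p (Nat.card ↥((powMonoidHom p :
          ClassGroup (𝓞 (fixedField (V n) : IntermediateField K (AlgebraicClosure K))) →*
            ClassGroup (𝓞 (fixedField (V n) : IntermediateField K (AlgebraicClosure K)))).ker ⊓
          (classGroupNorm (maximalRealSubfield (fixedField (V n) : IntermediateField K (AlgebraicClosure K)))
            (fixedField (V n) : IntermediateField K (AlgebraicClosure K))).ker)) ≤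
        padicValNat p (Nat.card (ClassGroup (𝓞 (fixedField (V n) : IntermediateField K (AlgebraicClosure K))))) := by
      have hne : Nat.card (ClassGroup (𝓞 (fixedField (V n) : IntermediateField K (AlgebraicClosure K)))) ≠ 0 :=
        Nat.card_pos.ne'
      exact (padicValNat_dvd_iff_le hne).mp (pow_padicValNat_dvd.trans (Subgroup.card_subgroup_dvd_card _))
    have hg := hgrowth n hn
    calc _ ≤ 1 + N.index + (l * n + ν) := by gcongr; exact hC.trans hg
      _ = l * n + (1 + N.index + ν) := by ring
  exact finite_unramifiedOutside_of_layerData hp2 κ hcont hpM hcardM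
    (fun n => V n ⊔ Subgroup.zpowers c) hUopen hUle hUtriv hUcop
    (fun n => (fixedField (V n) : IntermediateField K (AlgebraicClosure K))) eL
    (fun n => ⟨ζ, hζV n⟩) hζ' (a := l) (b := 1 + N.index + ν) (n₀ := n₀) hbound

end Literature.NumberTheory.IwasawaTheory.UnramifiedOutsidePFiniteOfCMTower

end
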